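import Summits.ValiantsHypothesis.ValiantsHypothesis.Theorems.GrenetZeonPolySizeQPAlgebraShallowSemisimple
import Summits.ValiantsHypothesis.ValiantsHypothesis.Theorems.GrenetZeonPolySizeQPAlgebraSumsOfDeterminants
import HarnessLib

/-!
# The depth axis of the piece `PolySizeQPAlgebra` (stmt-ValiantsHypothesis-8064)

Helper file for stmt-8064 (line `vbp-slice-dealg`) of route `GrenetZeon`, companion of
`GrenetZeonPolySizeQPAlgebraShallowSemisimple.lean` (semisimplification `eq_sum_dets_of_depth`:
an `(m, s)`-representation over a local coefficient algebra of Loewy depth `ν` is a sum of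
`≤ (m (s - 1) + 1)^(ν - 1)` affine `m × m` determinants over `ℂ`).

`not_sum_dets_of_polySizeQPAlgebra` (landed) is the rung «`PolySizeQPAlgebra` ⟹ `per_n` is not a
quasi-polynomially long sum of polynomial-size affine determinants».  Here the converse reading:
that rung already EXCLUDES every LOCAL coefficient algebra of polylogarithmic depth in the
polynomial-size / quasi-polynomial-dimension box of the piece.

## Main results

* `depth_budget` — bookkeeping: `m ≤ n^c + c`, `s ≤ 2^((log₂ n + c)^c)`, `ν ≤ (log₂ n + c)^c` give
  `((m + 1) s)^ν ≤ 2^((log₂ n + 2c + 4)^(2c + 4))`.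
* `polySizeBox_shallow_of_not_sum_dets` — ΣDet exclusion ⟹ for all large `n`, no representation of
  `per_n` in the box over a local algebra with `(ker φ)^((log₂ n + c)^c) = 0`.
* `polySizeBox_shallow_of_polySizeQPAlgebra` — hence the polylog-depth part of the piece is
  EQUIVALENT to the sums-of-determinants exclusion (a statement over `ℂ` alone): inside the box,
  commuting coefficients can beat sums of determinants only through nilpotents of depth beyond
  polylog `n` (the zeon algebra behind the point `(n, 2^n)` has depth `n + 1`).  Census for the
  planner: the content of the `s`-axis is DEPTH, not dimension.

No stub of the line is closed; `VP ≠ VNP` is not touched.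

## References

* P. Hrubeš, A. Yehudayoff, *Arithmetic complexity in ring extensions*, Theory of Computing 7
  (2011), §2. [cite: HrubesYehudayoff2011, §2]
-/

set_option linter.dupNamespace false

noncomputable section

namespace Summit.ValiantsHypothesis.ValiantsHypothesis.Theorems.GrenetZeonPolySizeQPAlgebra

open MvPolynomial Matrix
open Literature.Computability.AlgebraicComplexity
open Summit.ValiantsHypothesis.ValiantsHypothesis.Theses.GrenetZeon

universe u v

section Packaging

variable {k : Type u} [Field k] {σ : Type v}

/-- **Shallow ⟹ semisimple.** Under the hypotheses of `eq_sum_dets_of_depth` and `dim R ≤ s`,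
`f` has an `(m, (m (s - 1) + 1)^(ν - 1))`-representation over the split semisimple algebra
`k^G` (`hasAlgDetRepr_sum_dets`): local coefficient algebras of depth `ν` are simulated by sums of
determinants OF THE SAME SIZE at polynomial cost for bounded `ν`. [cite: HrubesYehudayoff2011, §2] -/
theorem hasAlgDetRepr_semisimple_of_depth {f : MvPolynomial σ k} {m s : ℕ} {R : Type u}
    [CommRing R] [Algebra k R] [Module.Finite k R] (φ : R →ₐ[k] k) {ν : ℕ}
    (hν : (RingHom.ker φ) ^ ν = ⊥) (hs : Module.finrank k R ≤ s) (l : R →ₗ[k] k)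
    (A : Matrix (Fin m) (Fin m) (MvPolynomial σ R)) (hA : ∀ i j, (A i j).totalDegree ≤ 1)
    (hf : ∀ d : σ →₀ ℕ, l (coeff d A.det) = coeff d f) :
    HasAlgDetRepr f m ((m * (s - 1) + 1) ^ (ν - 1)) := by
  obtain ⟨G, α, B, hG, hB, hfB⟩ := eq_sum_dets_of_depth_le φ hν hs l A hA hf
  have h := hasAlgDetRepr_sum_dets B hB α
  rw [← hfB] at h
  exact h.mono le_rfl hG

end Packaging

/-! ### The depth axis of the piece `PolySizeQPAlgebra` (stmt-8064)

`not_sum_dets_of_polySizeQPAlgebra` (this directory) is the rung «`PolySizeQPAlgebra` ⟹ `per_n`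
is not a quasi-polynomially long sum of polynomial-size affine determinants».  Conversely, that
rung already EXCLUDES every LOCAL coefficient algebra of polylogarithmic depth in the
polynomial-size / quasi-polynomial-dimension box: the `s`-axis can beat sums of determinants only
through DEEP nilpotents (Loewy depth beyond polylog `n` — the zeon algebra behind the point
`(n, 2^n)` has depth `n + 1`). -/

section DepthAxis

/-- Quasi-polynomial bookkeeping for the depth axis: with `L = log₂ n`, `m ≤ n^c + c`, `1 ≤ s ≤ 2^((L + c)^c)` and `ν ≤ (L + c)^c`,
`((m + 1) s)^ν ≤ 2^((L + (2c + 4))^(2c + 4))`. [folklore] -/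
theorem depth_budget {n c m s ν : ℕ} (hm : m ≤ n ^ c + c)
    (hs : s ≤ 2 ^ ((Nat.log 2 n + c) ^ c)) (hν : ν ≤ (Nat.log 2 n + c) ^ c) :
    ((m + 1) * s) ^ ν ≤ 2 ^ ((Nat.log 2 n + (2 * c + 4)) ^ (2 * c + 4)) := by
  set L := Nat.log 2 n with hL
  set X := L + (2 * c + 4) with hX
  have hX2 : 2 ≤ X := by omega
  have hcX : c ≤ X := by omega
  have hnX : n ≤ 2 ^ X := by
    have h1 : n < 2 ^ (L + 1) := Nat.lt_pow_succ_log_self (by norm_num) n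
    exact h1.le.trans (Nat.pow_le_pow_right (by norm_num) (by omega))
  have hXpow : ∀ a b : ℕ, a ≤ b → X ^ a ≤ X ^ b := fun a b hab =>
    Nat.pow_le_pow_right (by omega) hab
  -- n^c + c + 1 ≤ 2^(X^3)
  have hnc : n ^ c ≤ 2 ^ (X ^ 2) := by
    calc n ^ c ≤ (2 ^ X) ^ c := Nat.pow_le_pow_left hnX c
      _ = 2 ^ (X * c) := by rw [← pow_mul]
      _ ≤ 2 ^ (X ^ 2) := Nat.pow_le_pow_right (by norm_num)
          (by rw [sq]; exact Nat.mul_le_mul_left X hcX)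
  have hc1 : c + 1 ≤ 2 ^ (X ^ 2) := by
    calc c + 1 ≤ X := by omega
      _ ≤ 2 ^ X := (Nat.lt_two_pow_self).le
      _ ≤ 2 ^ (X ^ 2) := Nat.pow_le_pow_right (by norm_num) (by nlinarith)
  have hm1 : m + 1 ≤ 2 ^ (X ^ 3) := by
    have h1 : m + 1 ≤ 2 ^ (X ^ 2) + 2 ^ (X ^ 2) := by omega
    have h2 : 2 ^ (X ^ 2) + 2 ^ (X ^ 2) = 2 ^ (X ^ 2 + 1) := by rw [pow_succ]; ring
    have h3 : X ^ 2 + 1 ≤ X ^ 3 := by nlinarith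
    rw [h2] at h1
    exact h1.trans (Nat.pow_le_pow_right (by norm_num) h3)
  -- s ≤ 2^(X^c)
  have hLc : (L + c) ^ c ≤ X ^ c := Nat.pow_le_pow_left (by omega) c
  have hs' : s ≤ 2 ^ (X ^ c) := hs.trans (Nat.pow_le_pow_right (by norm_num) hLc)
  -- base
  have hbase : (m + 1) * s ≤ 2 ^ (X ^ (c + 4)) := by
    calc (m + 1) * s ≤ 2 ^ (X ^ 3) * 2 ^ (X ^ c) := Nat.mul_le_mul hm1 hs'
      _ = 2 ^ (X ^ 3 + X ^ c) := by rw [← pow_add]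
      _ ≤ 2 ^ (X ^ (c + 4)) := Nat.pow_le_pow_right (by norm_num) (by
          have h1 : X ^ 3 ≤ X ^ (c + 3) := hXpow 3 (c + 3) (by omega)
          have h2 : X ^ c ≤ X ^ (c + 3) := hXpow c (c + 3) (by omega)
          calc X ^ 3 + X ^ c ≤ 2 * X ^ (c + 3) := by omega
            _ ≤ X * X ^ (c + 3) := Nat.mul_le_mul_right _ hX2
            _ = X ^ (c + 4) := by ring)
  calc ((m + 1) * s) ^ ν ≤ (2 ^ (X ^ (c + 4))) ^ ν := Nat.pow_le_pow_left hbase ν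
    _ = 2 ^ (X ^ (c + 4) * ν) := by rw [← pow_mul]
    _ ≤ 2 ^ (X ^ (2 * c + 4)) := Nat.pow_le_pow_right (by norm_num) (by
        calc X ^ (c + 4) * ν ≤ X ^ (c + 4) * X ^ c := Nat.mul_le_mul_left _ (hν.trans hLc)
          _ = X ^ (2 * c + 4) := by rw [← pow_add]; ring_nf)

/-- **The ΣDet rung excludes every shallow local coefficient algebra (depth axis of stmt-8064).**
If, for every `c`, for all large `n`, `per_n` is not a linear combination of `≤ 2^((log₂ n + c)^c)`
affine determinants of size `≤ n^c + c` (the conclusion of `not_sum_dets_of_polySizeQPAlgebra`),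
then for every `c`, for all large `n`, `per_n` has NO `(m, s)`-representation with `m ≤ n^c + c`,
`s ≤ 2^((log₂ n + c)^c)` over any LOCAL coefficient algebra `R` (character `φ`) of depth
`(ker φ)^((log₂ n + c)^c) = 0` — polylogarithmic Loewy depth.  By `eq_sum_dets_of_depth` such a
representation is a sum of `≤ ((m + 1) s)^depth ≤ 2^((log₂ n + 2c + 4)^(2c + 4))` determinants of
the same size (`depth_budget`).  So inside the box of the piece, commuting coefficients can only
matter through nilpotents of depth beyond polylog `n`. [cite: HrubesYehudayoff2011, §2] -/
theorem polySizeBox_shallow_of_not_sum_dets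
    (hSum : ∀ c : ℕ, ∃ n₀ : ℕ, ∀ n ≥ n₀, ∀ m s : ℕ, m ≤ n ^ c + c → s ≤ 2 ^ ((Nat.log 2 n + c) ^ c) →
      ∀ (A : Fin s → Matrix (Fin m) (Fin m) (MvPolynomial (Fin n × Fin n) ℂ)) (α : Fin s → ℂ),
        (∀ i j k, (A i j k).totalDegree ≤ 1) → perPoly (Fin n) ℂ ≠ ∑ i, C (α i) * (A i).det)
    (c : ℕ) :
    ∃ n₀ : ℕ, ∀ n ≥ n₀, ∀ m s : ℕ, m ≤ n ^ c + c → s ≤ 2 ^ ((Nat.log 2 n + c) ^ c) →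
      ∀ (R : Type) [CommRing R] [Algebra ℂ R] [Module.Finite ℂ R] (φ : R →ₐ[ℂ] ℂ),
        (RingHom.ker φ) ^ ((Nat.log 2 n + c) ^ c) = ⊥ → Module.finrank ℂ R ≤ s →
          ∀ (l : R →ₗ[ℂ] ℂ) (A : Matrix (Fin m) (Fin m) (MvPolynomial (Fin n × Fin n) R)),
            (∀ i j, (A i j).totalDegree ≤ 1) →
              ¬ ∀ d : (Fin n × Fin n) →₀ ℕ, l (coeff d A.det) = coeff d (perPoly (Fin n) ℂ) := by
  obtain ⟨n₀, h⟩ := hSum (2 * c + 4)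
  refine ⟨max n₀ 1, fun n hn m s hm hs R _ _ _ φ hν hR l A hA hf => ?_⟩
  have hn₀ : n₀ ≤ n := le_of_max_le_left hn
  have hn1 : 1 ≤ n := le_of_max_le_right hn
  obtain ⟨G, α, B, hG, hB, hper⟩ := eq_sum_dets_of_depth_le φ hν hR l A hA hf
  -- `1 ≤ s`: `R` is nontrivial (`φ 1 = 1`), so `1 ≤ finrank R ≤ s`
  have hs1 : 1 ≤ s := by
    have := finrank_ker_character_le (k := ℂ) φ
    have hpos : 0 < Module.finrank ℂ R := by
      haveI : Nontrivial R := ⟨⟨1, 0, fun h10 => one_ne_zero ((map_one φ).symm.trans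
        (by rw [h10, map_zero]))⟩⟩
      exact Module.finrank_pos
    omega
  have hG' : G ≤ 2 ^ ((Nat.log 2 n + (2 * c + 4)) ^ (2 * c + 4)) := by
    have h1 : m * (s - 1) + 1 ≤ (m + 1) * s := by
      have : m * (s - 1) + m = m * s := by
        rw [← Nat.mul_succ, Nat.succ_eq_add_one, Nat.sub_add_cancel hs1]
      nlinarith
    calc G ≤ (m * (s - 1) + 1) ^ ((Nat.log 2 n + c) ^ c - 1) := hG
      _ ≤ ((m + 1) * s) ^ ((Nat.log 2 n + c) ^ c - 1) := Nat.pow_le_pow_left h1 _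
      _ ≤ ((m + 1) * s) ^ ((Nat.log 2 n + c) ^ c) :=
          Nat.pow_le_pow_right (Nat.mul_pos (Nat.succ_pos m) hs1) (Nat.sub_le _ _)
      _ ≤ 2 ^ ((Nat.log 2 n + (2 * c + 4)) ^ (2 * c + 4)) := depth_budget hm hs le_rfl
  have hm' : m ≤ n ^ (2 * c + 4) + (2 * c + 4) :=
    hm.trans (Nat.add_le_add (Nat.pow_le_pow_right hn1 (by omega)) (by omega))
  exact h n hn₀ m G hm' hG' B α hB hper

/-- **Corollary: `PolySizeQPAlgebra` decides its own shallow part through the ΣDet rung.**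
`PolySizeQPAlgebra` ⟹ (no qp-long sum of poly-size determinants, `not_sum_dets_of_polySizeQPAlgebra`)
⟹ (no shallow local representation in the box, `polySizeBox_shallow_of_not_sum_dets`): the part
of the piece concerning coefficient algebras of polylogarithmic depth is EQUIVALENT to the
sums-of-determinants exclusion, a statement about `ℂ` alone. [cite: HrubesYehudayoff2011, §2] -/
theorem polySizeBox_shallow_of_polySizeQPAlgebra (hP : PolySizeQPAlgebra) (c : ℕ) :
    ∃ n₀ : ℕ, ∀ n ≥ n₀, ∀ m s : ℕ, m ≤ n ^ c + c → s ≤ 2 ^ ((Nat.log 2 n + c) ^ c) →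
      ∀ (R : Type) [CommRing R] [Algebra ℂ R] [Module.Finite ℂ R] (φ : R →ₐ[ℂ] ℂ),
        (RingHom.ker φ) ^ ((Nat.log 2 n + c) ^ c) = ⊥ → Module.finrank ℂ R ≤ s →
          ∀ (l : R →ₗ[ℂ] ℂ) (A : Matrix (Fin m) (Fin m) (MvPolynomial (Fin n × Fin n) R)),
            (∀ i j, (A i j).totalDegree ≤ 1) →
              ¬ ∀ d : (Fin n × Fin n) →₀ ℕ, l (coeff d A.det) = coeff d (perPoly (Fin n) ℂ) :=
  polySizeBox_shallow_of_not_sum_dets (not_sum_dets_of_polySizeQPAlgebra hP) c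

end DepthAxis




end Summit.ValiantsHypothesis.ValiantsHypothesis.Theorems.GrenetZeonPolySizeQPAlgebra

end
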